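import Literature.Analysis.FluidPDE.TorusABCFlow
import Literature.Analysis.FunctionSpaces.TorusFluidGlue
import HarnessLib

/-!
# Non-uniqueness of Hölder `C^{1/2−}` weak solutions of the FORCED Euler equations on `𝕋³`
# from arbitrary smooth data (Bulut–Huynh–Palasek 2023, convex integration above Onsager)

Analysis/FluidPDE Literature file: one definition with body (the weak formulation of the Euler
equations on the flat torus with a DISTRIBUTIONAL body force `f = div F`, `F` a continuous
2-tensor field — the printed regularity of the force, `F ∈ C⁰_t C^{2β−}_x` with `2β < 1`, makes
`f` a genuine distribution, so the accepted function-forced predicate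
`Literature.Analysis.FluidPDE.Torus.IsWeakNSSolutionForcedOn` does not apply), its unfolding /
consistency lemma with the accepted unforced predicate
`Literature.Analysis.FunctionSpaces.Torus.IsWeakNSSolutionWithDataOn` (`F = 0`, `ν = 0`), ONE named
fact `BulutHuynhPalasek2023_forcedEulerNonuniqueness` (Thm. 1.1 of A. Bulut, M. K. Huynh,
S. Palasek, *Convex integration above the Onsager exponent for the forced Euler equations*,
arXiv:2301.00804 (2023), in its `d = 3` case on the unit torus), and a PROVED corollary
extracting the printed slogan "for any choice of smooth data there exists an external force such
that uniqueness of the initial value problem fails" in the concrete form of two distinct weak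
solutions from the ZERO datum (`…​.exists_two_solutions_zero_datum`, the second endpoint being
the tree's ABC flow `Literature.Analysis.FluidPDE.Torus.abcFlow 1 0 0`).

## What is printed (arXiv:2301.00804)

* (1.1): the incompressible Euler equations with external force on `𝕋ᵈ`, `d ≥ 3`:
  `∂ₜv + div(v ⊗ v) + ∇p = f`, `div v = 0`, `v : [0,T] × 𝕋ᵈ → ℝᵈ`.
* **Thm. 1.1** (p. 2): "With `d ≥ 3`, let `V₁, V₂, V₃ ∈ C^∞(𝕋ᵈ → ℝᵈ)` be any divergence-free
  vector fields such that `∫ V₁ = ∫ V₂ = ∫ V₃`. Then for every `β ∈ (0, ½)` there exist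
  `u, v ∈ C^{β−}_{t,x}` and `F ∈ C⁰_t C^{2β−}_x` such that • `u, v` are weak solutions to (1.1)
  with common initial data `u(0) = v(0) = V₁` and force `f = div F`, • `u(T) = V₃`, `v(T) = V₂`,
  and • `u`, `v`, and `F` are smooth for almost all times. In particular, for any choice of
  smooth data, there exists an external force such that uniqueness of the initial value problem
  fails." (§2: `x−` means "for all `y ∈ (x−ε, x)`, `ε` small"; `‖·‖_{N+α} = C^{N,α}` norms.)
* Rem. 1.2: for `β > 1/3` the pair (velocity, force) is regular enough for the ENERGY BALANCE
  (App. C) — "above the Onsager threshold"; `F` barely fails to be `C¹_x`, `f = div F` barely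
  fails to be continuous; the total work `∫∫ f·v` is finite. §1.2: the solutions are "genuinely
  `d`-dimensional", unlike Vishik's unstable vortex. §3 (proof of Thm. 1.1): `T` is arbitrary —
  the construction rescales time (`u₀^ζ(t,x) = ζu₀(ζt,x)`, `F₀^ζ = ζ²F₀(ζt,x)`) so that the
  iterative Prop. 2.1 (stated for `T ≥ 1`) applies; `V₂, V₃` are reached EXACTLY at `t = T` via
  short-time smooth Euler solutions glued in by a temporal cut-off.

## Rendering (unit torus, `d = 3`; WEAKER than print)

* `d = 3` only (print: every `d ≥ 3`); the tree's torus `UnitAddTorus (Fin 3) = (ℝ/ℤ)³` (the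
  Euler scaling `v ↦ (ℓ/τ)v(t/τ, x/ℓ)`, `F ↦ (ℓ/τ)²F(t/τ, x/ℓ)` transports the statement between
  periods and time intervals and preserves every clause; print itself rescales time, §3).
* `C^{β−}`: print gives, for each `β₁ < ½`, solutions in `C^{y}` for all `y < β₁`; the fact asks,
  for each `β < ½`, `u, v ∈ C^{β}_{t,x}` and `F(t) ∈ C^{2β}_x` uniformly in `t` — apply print with
  any `β₁ ∈ (β, ½)`. Hölder continuity is recorded through Mathlib's `HolderOnWith` for the
  space–time lift `Torus.stLift u` on `[0,T] × ℝ³` (sup product metric = joint space–time Hölder)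
  and `HolderWith` for the spatial lifts `Torus.lift (F t)`, `t ∈ [0,T]`; `F ∈ C⁰_t` as
  `ContinuousOn (Torus.stLift F) ([0,T] × ℝ³)`.
* Weak solution with force `div F`: `Torus.IsWeakEulerSolutionStressForcedOn T F V₁ u` (this
  file) — the accepted `[0,T)`-weak identity of `Torus.IsWeakNSSolutionWithDataOn` /
  `Torus.IsWeakNSSolutionForcedOn` with `ν = 0` and the force pairing `∫∫⟪f, ψ⟫` replaced by
  `−∫∫ F : ∇ψ = −∫∫ Σⱼ ⟪F_j, ∂ⱼψ⟫` (`(div F)ᵢ = ∂ⱼF_{ji}`, §2.1: "`(div T)_{i₁…} = ∇_j T_{j i₁…}`";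
  `F t x j ∈ ℝ³` is the row `F_{j·}`); the tensor is stored as `𝕋³ → (Fin 3 → ℝ³)`. Since `F` is
  existentially quantified together with its continuity, the transposition convention is
  immaterial and the Bochner pairings are honest (no junk integrals).
* Endpoint data: `u 0 = V₁`, `u T = V₃` (and `v 0 = V₁`, `v T = V₂`) as pointwise slice
  equalities (the solutions are continuous); the datum also enters the weak identity.
* "smooth for almost all times": for a.e. `t ∈ (0,T)` the slices `u t`, `v t`, `F t` are
  `Torus.IsSmooth` (spatially `C^∞`) — weaker than joint smoothness on an open full-measure set
  of times.

## What is NOT here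

The energy balance of Rem. 1.2 / App. C; dimensions `d ≥ 4`; the structure of the construction
(alternating convex integration, Mikado building blocks, bad-time sets `B_q`); quantitative
Hölder norms. Nothing here concerns viscosity `ν > 0`: the hypodissipative Navier–Stokes results of
the same authors (arXiv:2201.05600) are the catalogued barrier
`Literature.Barriers.NavierStokesRegularity.HypodissipativeLerayNonuniqueness`.

## References

* A. Bulut, M. K. Huynh, S. Palasek, *Convex integration above the Onsager exponent for the forced
  Euler equations*, arXiv:2301.00804 (2023), Thm. 1.1, Rem. 1.2, §2.1–2.3, §3. [`BulutHuynhPalasek2023`]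
* C. De Lellis, L. Székelyhidi Jr., Arch. Ration. Mech. Anal. 195 (2010), §1 (weak solutions of
  Euler on `𝕋³`). [`LellisSzekelyhidi2009`]
* T. Buckmaster, V. Vicol, Ann. of Math. 189 (2019), Def. 1.1. [`BuckmasterVicol2019`]
* A. J. Majda, A. L. Bertozzi, *Vorticity and Incompressible Flow*, CUP 2002, §2.3.2 Ex. 2.8 (ABC
  flows). [`MajdaBertozziCUP2002`]
-/

noncomputable section

open MeasureTheory Set Filter UnitAddTorus
open scoped NNReal ENNReal RealInnerProductSpace

/-! ### The weak Euler identity with a distributional force `div F` -/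

namespace Literature.Analysis.FluidPDE.Torus

variable {d : Type*} [Fintype d] [DecidableEq d]

/-- **Weak solutions of the forced Euler equations on the flat torus with a DISTRIBUTIONAL body
force `f = div F`.** For a 2-tensor field `F : [0,T) × T^d → ℝ^{d×d}` stored row-wise
(`F t x j ∈ ℝ^d` is the row `(F_{j i})_i`, so `(div F)_i = Σ_j ∂_j F_{j i}`), a field
`u : [0,T) × T^d → ℝ^d` is a weak (pressure-free) solution of `∂ₜu + div(u ⊗ u) + ∇p = div F`,
`div u = 0`, `u(0) = u₀` if: its space–time lift is a.e.-strongly measurable on `(0,T) × ℝ^d`,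
`u ∈ L²_{t,x}`, `u(t)` is weakly divergence free for a.e. `t`, and for every smooth divergence-free
test field `ψ` compactly supported in time in `[0,T)`
`∫₀ᵀ∫ (⟪u, ∂ₜψ⟫ + ⟪u, (u·∇)ψ⟫ − Σⱼ ⟪F_j, ∂ⱼψ⟫) dx dt + ∫ ⟪u₀, ψ(0)⟫ = 0`
— the accepted datum-carrying weak identity `Torus.IsWeakNSSolutionWithDataOn` /
`Torus.IsWeakNSSolutionForcedOn` with `ν = 0` and the force pairing `+∫∫⟪f,ψ⟫` integrated by parts
into `−∫∫ F : ∇ψ` (Bulut–Huynh–Palasek 2023, (1.1) with `f = div F` and §2.1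
"`(div T)_{i₁…i_k} = ∇_j T_{j i₁…i_k}`"; De Lellis–Székelyhidi 2009 §1 / Buckmaster–Vicol 2019
Def. 1.1 for the weak form). Junk note: meaningful for `F` locally integrable in `x` (in this
file `F` is always continuous); `F = 0` recovers the accepted unforced predicate
(`isWeakEulerSolutionStressForcedOn_zero_iff`). [cite: BulutHuynhPalasek2023, §1 (1.1) and Thm. 1.1 ("force f = div F"), §2.1] -/
def IsWeakEulerSolutionStressForcedOn (T : ℝ) (F : ℝ → UnitAddTorus d → d → EuclideanSpace ℝ d)
    (u₀ : UnitAddTorus d → EuclideanSpace ℝ d) (u : ℝ → UnitAddTorus d → EuclideanSpace ℝ d) :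
    Prop :=
  AEStronglyMeasurable (FunctionSpaces.Torus.stLift u) (volume.restrict (Ioo 0 T ×ˢ univ)) ∧
    (∫⁻ t in Ioo 0 T, ∫⁻ x, ‖u t x‖ₑ ^ 2 < ∞) ∧
    (∀ᵐ t ∂(volume.restrict (Ioo 0 T)), FunctionSpaces.Torus.IsWeaklyDivFree (u t)) ∧
    ∀ ψ : ℝ → UnitAddTorus d → EuclideanSpace ℝ d, FunctionSpaces.Torus.IsSpaceTimeTest T ψ →
      FunctionSpaces.Torus.IsDivFreeTest ψ →
      (∫ t in Ioo 0 T, ∫ x, (⟪u t x, FunctionSpaces.Torus.timeDeriv ψ t x⟫ +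
          ⟪u t x, FunctionSpaces.Torus.convect (u t) (ψ t) x⟫ -
          ∑ j, ⟪F t x j, FunctionSpaces.Torus.partialDeriv j (ψ t) x⟫)) +
        ∫ x, ⟪u₀ x, ψ 0 x⟫ = 0

/-- **Consistency with the accepted unforced predicate**: with the zero stress `F = 0` the
stress-forced weak Euler identity is literally the accepted datum-carrying weak identity
`Torus.IsWeakNSSolutionWithDataOn T 0 u₀ u` of the Euler equations (`ν = 0`)
(De Lellis–Székelyhidi 2009 §1; Buckmaster–Vicol 2019 Def. 1.1: the datum-carrying weak
formulation). [cite: BuckmasterVicol2019, Def. 1.1] -/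
theorem isWeakEulerSolutionStressForcedOn_zero_iff {T : ℝ}
    {u₀ : UnitAddTorus d → EuclideanSpace ℝ d} {u : ℝ → UnitAddTorus d → EuclideanSpace ℝ d} :
    IsWeakEulerSolutionStressForcedOn T 0 u₀ u ↔
      FunctionSpaces.Torus.IsWeakNSSolutionWithDataOn T 0 u₀ u := by
  unfold IsWeakEulerSolutionStressForcedOn FunctionSpaces.Torus.IsWeakNSSolutionWithDataOn
  simp only [Pi.zero_apply, inner_zero_left, Finset.sum_const_zero, sub_zero, zero_mul, add_zero]

end Literature.Analysis.FluidPDE.Torus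

namespace Literature.Analysis.FluidPDE

open Literature.Analysis.FunctionSpaces

/-! ### The named fact (Thm. 1.1, `d = 3`) -/

/-- **Bulut–Huynh–Palasek 2023, Thm. 1.1 (`d = 3`, unit torus; weaker than print — module
docstring): non-unique `C^{1/2−}` weak solutions of the FORCED Euler equations connecting
arbitrary smooth data.** For all smooth divergence-free `V₁, V₂, V₃ : 𝕋³ → ℝ³` with equal means,
every `β ∈ (0, ½)` and every `T > 0` there are fields `u, v : [0,T] × 𝕋³ → ℝ³` and a 2-tensor
field `F` such that: `u, v` are `β`-Hölder jointly in space–time on `[0,T] × 𝕋³` (lifted: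
`HolderOnWith` on `[0,T] × ℝ³`); `F` is continuous on `[0,T] × 𝕋³` with `F(t) ∈ C^{2β}_x`
uniformly in `t`; `u` and `v` are weak solutions of the Euler equations with the SAME datum `V₁`
and the SAME distributional force `div F` (`Torus.IsWeakEulerSolutionStressForcedOn`), with
`u(0) = v(0) = V₁`, `u(T) = V₃`, `v(T) = V₂`; and for a.e. `t ∈ (0,T)` the slices `u(t)`,
`v(t)`, `F(t)` are smooth. "In particular, for any choice of smooth data, there exists an
external force such that uniqueness of the initial value problem fails" — above the Onsager
exponent `1/3`. [cite: BulutHuynhPalasek2023, Thm. 1.1 (with §2 for the notation C^{β−}, §3 for the arbitrary T)] -/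
def BulutHuynhPalasek2023_forcedEulerNonuniqueness : Prop :=
  ∀ (V₁ V₂ V₃ : UnitAddTorus (Fin 3) → EuclideanSpace ℝ (Fin 3)),
    Torus.IsSmooth V₁ → Torus.IsSmooth V₂ → Torus.IsSmooth V₃ →
    Torus.IsDivFree V₁ → Torus.IsDivFree V₂ → Torus.IsDivFree V₃ →
    ∫ x, V₁ x = ∫ x, V₂ x → ∫ x, V₁ x = ∫ x, V₃ x →
    ∀ β : ℝ, 0 < β → β < 1 / 2 → ∀ T : ℝ, 0 < T →
      ∃ (u v : ℝ → UnitAddTorus (Fin 3) → EuclideanSpace ℝ (Fin 3))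
        (F : ℝ → UnitAddTorus (Fin 3) → Fin 3 → EuclideanSpace ℝ (Fin 3)),
        (∃ C : ℝ≥0, HolderOnWith C (Real.toNNReal β) (Torus.stLift u) (Icc 0 T ×ˢ univ)) ∧
        (∃ C : ℝ≥0, HolderOnWith C (Real.toNNReal β) (Torus.stLift v) (Icc 0 T ×ˢ univ)) ∧
        ContinuousOn (Torus.stLift F) (Icc 0 T ×ˢ univ) ∧
        (∃ C : ℝ≥0, ∀ t ∈ Icc 0 T, HolderWith C (Real.toNNReal (2 * β)) (Torus.lift (F t))) ∧
        Torus.IsWeakEulerSolutionStressForcedOn T F V₁ u ∧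
        Torus.IsWeakEulerSolutionStressForcedOn T F V₁ v ∧
        u 0 = V₁ ∧ v 0 = V₁ ∧ u T = V₃ ∧ v T = V₂ ∧
        ∀ᵐ t ∂(volume.restrict (Ioo 0 T)),
          Torus.IsSmooth (u t) ∧ Torus.IsSmooth (v t) ∧ Torus.IsSmooth (F t)

/-! ### Proved consequence: two distinct weak solutions from the zero datum -/

/-- The ABC flow `u_{ABC}(1,0,0)` is not the zero field (its `L²` mass is `1`,
`Torus.integral_norm_sq_abcFlow`). [folklore] -/
private theorem Torus.abcFlow_one_zero_zero_ne_zero : Torus.abcFlow 1 0 0 ≠ 0 := by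
  intro h
  have hmass := Torus.integral_norm_sq_abcFlow 1 0 0
  rw [h] at hmass
  norm_num at hmass

/-- The ABC flow with zero amplitudes is the zero field. [folklore] -/
private theorem Torus.abcFlow_zero_zero_zero : Torus.abcFlow 0 0 0 = 0 := by
  funext x
  ext i
  have h0 : ∀ j : Fin 3, Torus.abcAmp 0 0 0 j = 0 := fun j => by
    fin_cases j <;> simp [Torus.abcAmp]
  simp [Torus.abcFlow_apply, h0]

/-- The zero field on `T³` is divergence free (transported from `Torus.isDivFree_abcFlow 0 0 0`).
[folklore] -/
private theorem Torus.isDivFree_zero_fin_three :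
    Torus.IsDivFree (0 : UnitAddTorus (Fin 3) → EuclideanSpace ℝ (Fin 3)) := by
  have h := Torus.isDivFree_abcFlow 0 0 0
  rwa [Torus.abcFlow_zero_zero_zero] at h

/-- **"For any choice of smooth data there exists an external force such that uniqueness of the
initial value problem fails"** (Bulut–Huynh–Palasek 2023, Thm. 1.1, last sentence), PROVED from
the fact in the concrete instance: from the ZERO datum on `𝕋³`, for every `T > 0` there are a
continuous stress `F` (with `F(t) ∈ C^{2β}`, any prescribed `β < ½`) and two `β`-Hölder weak
solutions `u ≠ v` of the Euler equations forced by `div F` — obtained with `V₁ = V₂ = 0` and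
`V₃ =` the ABC flow `u_{ABC}(1,0,0)` (smooth, divergence free, mean zero, non-zero), so that
`u(T) ≠ v(T)`. [cite: BulutHuynhPalasek2023, Thm. 1.1] -/
theorem BulutHuynhPalasek2023_forcedEulerNonuniqueness.exists_two_solutions_zero_datum
    (h : BulutHuynhPalasek2023_forcedEulerNonuniqueness) {β : ℝ} (hβ : 0 < β) (hβ' : β < 1 / 2)
    {T : ℝ} (hT : 0 < T) :
    ∃ (u v : ℝ → UnitAddTorus (Fin 3) → EuclideanSpace ℝ (Fin 3))
      (F : ℝ → UnitAddTorus (Fin 3) → Fin 3 → EuclideanSpace ℝ (Fin 3)),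
      (∃ C : ℝ≥0, HolderOnWith C (Real.toNNReal β) (Torus.stLift u) (Icc 0 T ×ˢ univ)) ∧
      (∃ C : ℝ≥0, HolderOnWith C (Real.toNNReal β) (Torus.stLift v) (Icc 0 T ×ˢ univ)) ∧
      ContinuousOn (Torus.stLift F) (Icc 0 T ×ˢ univ) ∧
      (∃ C : ℝ≥0, ∀ t ∈ Icc 0 T, HolderWith C (Real.toNNReal (2 * β)) (Torus.lift (F t))) ∧
      Torus.IsWeakEulerSolutionStressForcedOn T F 0 u ∧
      Torus.IsWeakEulerSolutionStressForcedOn T F 0 v ∧ u ≠ v := by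
  have h0s : Torus.IsSmooth (0 : UnitAddTorus (Fin 3) → EuclideanSpace ℝ (Fin 3)) :=
    Torus.isSmooth_const _
  have h0d : Torus.IsDivFree (0 : UnitAddTorus (Fin 3) → EuclideanSpace ℝ (Fin 3)) :=
    Torus.isDivFree_zero_fin_three
  have hmean : ∫ x, (0 : UnitAddTorus (Fin 3) → EuclideanSpace ℝ (Fin 3)) x =
      ∫ x, Torus.abcFlow 1 0 0 x := by
    rw [Torus.hasZeroMean_abcFlow 1 0 0]
    simp
  obtain ⟨u, v, F, hu, hv, hFc, hFh, hwu, hwv, -, -, huT, hvT, -⟩ :=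
    h 0 0 (Torus.abcFlow 1 0 0) h0s h0s (Torus.isSmooth_abcFlow 1 0 0) h0d h0d
      (Torus.isDivFree_abcFlow 1 0 0) rfl hmean β hβ hβ' T hT
  refine ⟨u, v, F, hu, hv, hFc, hFh, hwu, hwv, fun huv => ?_⟩
  have : Torus.abcFlow 1 0 0 = 0 := by rw [← huT, huv, hvT]
  exact Torus.abcFlow_one_zero_zero_ne_zero this

end Literature.Analysis.FluidPDE
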